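import Summits.CriticalPhenomena.PercolationContinuityZ3.Theorems.Transplant.Slab111VPaths
import Summits.CriticalPhenomena.PercolationContinuityZ3.Theorems.Transplant.VPathKit
import HarnessLib

/-!
# Paths in the `(111)`-films `F_k`, II: vertices by (column, LEVEL), up-steps by level, and FACE HELICES as self-avoiding paths

builds on p205010 (kernel theorem, internal audit signed; external expert review pending) — NOT used in this file.  Lane `prim-bschramm`, seat
`prim-bschramm-p2` (gen 34; class C1b; memo `HOME/bschramm/P2-LATTICES.md` §127–§128); helper file (`--supports stmt-CriticalPhenomena-4575 --as helper`).
The vertical transport of the `F_k` routing template (there are no vertical edges in `F_k`): every triangular FACE of `𝕋` — columns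
`q, q + u_a, q + u_a + u_b` for an ordering `(a,b,c)` of the three up-directions — carries a HELIX of the film: the up-steps `u_a, u_b, u_c, u_a, …` climb one
level each and return to the column `q` every three steps, visiting every film vertex of the three columns.
* §1 `Slab111.lvl q = q₀ + 2q₁` (the level residue of the column), **`Slab111.vl k q ℓ`** (the vertex over `q` at LEVEL `ℓ`, `ℓ ≡ lvl q (mod 3)`), `sh_vl`,
  `lev_vl`, `vl_inj`, the up-step by level `adj_vl_up` (`(q, ℓ) ∼ (q + u, ℓ + 1)` for `u ∈ U`);
* §2 `faceCol q a b i` (the `i`-th column of the face cycle), **`helix k q a b ℓ₀ n`** (the `n`-step helix segment from `(q, ℓ₀)`), `helix_gpath` (it is a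
  `GPath` of the film from `vl q ℓ₀` to its last vertex), `mem_helix` (its vertices: face columns, levels `ℓ₀ … ℓ₀ + n`), `lev_of_mem_helix`.
[cite: GrimmettPercolation1999, §1.6 p. 16] [cite: DuminilCopinSidoraviciusTassion2016, §2.3 (proof of Fact 2: the paths γ_u, γ_v, γ_w)]
-/

noncomputable section

namespace Summit.CriticalPhenomena.PercolationContinuityZ3.Theorems.Transplant

open Literature.Probability.Percolation Literature.Probability.LatticeModels SimpleGraph
open scoped Classical

namespace Slab111

variable {k : ℕ}

/-! ## §1 Vertices by column and level -/

/-- The level residue datum of a column: the levels over `q` are `lvl q + 3ℤ = q₀ + 2q₁ + 3ℤ`. [folklore] -/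
def lvl (q : Site 2) : ℤ := q 0 + 2 * q 1

/-- **The vertex over the column `q` at level `ℓ`** (meaningful when `ℓ ≡ lvl q (mod 3)` and `0 ≤ ℓ ≤ k`): rung `(ℓ − lvl q)/3`. [folklore] -/
def vl (k : ℕ) (q : Site 2) (ℓ : ℤ) : slab111 k := vx k q ((ℓ - lvl q) / 3)

/-- A level is ADMISSIBLE over `q`: right residue and inside `[0, k]`. [folklore] -/
def Adm (k : ℕ) (q : Site 2) (ℓ : ℤ) : Prop := (3 : ℤ) ∣ ℓ - lvl q ∧ 0 ≤ ℓ ∧ ℓ ≤ k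

/-- An admissible level gives a rung in range, and `3·rung + lvl q = ℓ`. [folklore] -/
theorem rung_of_adm {q : Site 2} {ℓ : ℤ} (h : Adm k q ℓ) : Rung k q ((ℓ - lvl q) / 3) ∧ 3 * ((ℓ - lvl q) / 3) + lvl q = ℓ := by
  obtain ⟨⟨c, hc⟩, h0, hk⟩ := h
  have hdiv : (ℓ - lvl q) / 3 = c := by rw [hc]; simp
  refine ⟨⟨?_, ?_⟩, ?_⟩ <;> simp only [hdiv, lvl] at * <;> omega

/-- The shadow of `vl k q ℓ` is `q`. [folklore] -/
@[simp] theorem sh_vl {q : Site 2} {ℓ : ℤ} (h : Adm k q ℓ) : sh (vl k q ℓ) = q := sh_vx (rung_of_adm h).1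

/-- The level of `vl k q ℓ` is `ℓ`. [folklore] -/
@[simp] theorem lev_vl {q : Site 2} {ℓ : ℤ} (h : Adm k q ℓ) : lev ((vl k q ℓ : slab111 k) : Site 3) = ℓ := by
  rw [vl, lev_vx (rung_of_adm h).1]
  have := (rung_of_adm h).2
  simp only [lvl] at this ⊢; omega

/-- `vl` is injective on admissible data. [folklore] -/
theorem vl_inj {q q' : Site 2} {ℓ ℓ' : ℤ} (h : Adm k q ℓ) (h' : Adm k q' ℓ') : vl k q ℓ = vl k q' ℓ' ↔ q = q' ∧ ℓ = ℓ' := by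
  constructor
  · intro heq
    have hs : sh (vl k q ℓ) = sh (vl k q' ℓ') := by rw [heq]
    have hl : lev ((vl k q ℓ : slab111 k) : Site 3) = lev ((vl k q' ℓ' : slab111 k) : Site 3) := by rw [heq]
    rw [sh_vl h, sh_vl h'] at hs
    rw [lev_vl h, lev_vl h'] at hl
    exact ⟨hs, hl⟩
  · rintro ⟨rfl, rfl⟩; rfl

/-- Every film vertex is a `vl`: column `sh x`, level `lev x`. [folklore] -/
theorem exists_eq_vl (x : slab111 k) : Adm k (sh x) (lev (x : Site 3)) ∧ x = vl k (sh x) (lev (x : Site 3)) := by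
  have hx := mem_slab111_iff_lev.1 x.2
  have hadm : Adm k (sh x) (lev (x : Site 3)) := by
    refine ⟨⟨(x : Site 3) 1, ?_⟩, hx.1, hx.2⟩
    simp only [lvl, sh_apply_zero, sh_apply_one, lev]; ring
  refine ⟨hadm, ?_⟩
  apply eq_of_sh_eq_of_lev_eq
  · rw [sh_vl hadm]
  · rw [lev_vl hadm]

/-- `lvl` moves by `+1 (mod 3)` along every up-direction: `lvl (q + u₁) = lvl q + 1`, `lvl (q + u₂) = lvl q − 2`, `lvl (q + u₃) = lvl q + 1`. [folklore] -/
theorem lvl_add_u₁ (q : Site 2) : lvl (q + u₁) = lvl q + 1 := by simp [lvl]; ring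
/-- See `lvl_add_u₁`. [folklore] -/
theorem lvl_add_u₂ (q : Site 2) : lvl (q + u₂) = lvl q - 2 := by simp [lvl]; ring
/-- See `lvl_add_u₁`. [folklore] -/
theorem lvl_add_u₃ (q : Site 2) : lvl (q + u₃) = lvl q + 1 := by simp [lvl]; ring

/-- **Up-step by level along `u₁`**: `(q, ℓ) ∼ (q + u₁, ℓ + 1)`. [folklore] -/
theorem adj_vl_u₁ {q : Site 2} {ℓ : ℤ} (h : Adm k q ℓ) (h' : Adm k (q + u₁) (ℓ + 1)) : (film k).Adj (vl k q ℓ) (vl k (q + u₁) (ℓ + 1)) := by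
  have e : (ℓ + 1 - lvl (q + u₁)) / 3 = (ℓ - lvl q) / 3 := by rw [lvl_add_u₁]; ring_nf
  rw [vl, vl, e]
  exact adj_vx_u₁ (rung_of_adm h).1 (e ▸ (rung_of_adm h').1)

/-- **Up-step by level along `u₂`**: `(q, ℓ) ∼ (q + u₂, ℓ + 1)`. [folklore] -/
theorem adj_vl_u₂ {q : Site 2} {ℓ : ℤ} (h : Adm k q ℓ) (h' : Adm k (q + u₂) (ℓ + 1)) : (film k).Adj (vl k q ℓ) (vl k (q + u₂) (ℓ + 1)) := by
  have e : (ℓ + 1 - lvl (q + u₂)) / 3 = (ℓ - lvl q) / 3 + 1 := by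
    rw [lvl_add_u₂]
    have : ℓ + 1 - (lvl q - 2) = (ℓ - lvl q) + 3 := by ring
    rw [this, Int.add_ediv_of_dvd_right (dvd_refl 3)]; simp
  rw [vl, vl, e]
  exact adj_vx_u₂ (rung_of_adm h).1 (e ▸ (rung_of_adm h').1)

/-- **Up-step by level along `u₃`**: `(q, ℓ) ∼ (q + u₃, ℓ + 1)`. [folklore] -/
theorem adj_vl_u₃ {q : Site 2} {ℓ : ℤ} (h : Adm k q ℓ) (h' : Adm k (q + u₃) (ℓ + 1)) : (film k).Adj (vl k q ℓ) (vl k (q + u₃) (ℓ + 1)) := by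
  have e : (ℓ + 1 - lvl (q + u₃)) / 3 = (ℓ - lvl q) / 3 := by rw [lvl_add_u₃]; ring_nf
  rw [vl, vl, e]
  exact adj_vx_u₃ (rung_of_adm h).1 (e ▸ (rung_of_adm h').1)

/-- The three up-directions as a function of an index. [folklore] -/
def udir (i : ℕ) : Site 2 := if i % 3 = 0 then u₁ else if i % 3 = 1 then u₂ else u₃

/-- **Up-step by level along any `U`-direction.** [folklore] -/
theorem adj_vl_udir (i : ℕ) {q : Site 2} {ℓ : ℤ} (h : Adm k q ℓ) (h' : Adm k (q + udir i) (ℓ + 1)) :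
    (film k).Adj (vl k q ℓ) (vl k (q + udir i) (ℓ + 1)) := by
  unfold udir at *
  split_ifs at h' ⊢ with h1 h2
  · exact adj_vl_u₁ h h'
  · exact adj_vl_u₂ h h'
  · exact adj_vl_u₃ h h'

/-- The residue condition propagates along an up-step. [folklore] -/
theorem dvd_step (i : ℕ) {q : Site 2} {ℓ : ℤ} (h : (3 : ℤ) ∣ ℓ - lvl q) : (3 : ℤ) ∣ ℓ + 1 - lvl (q + udir i) := by
  unfold udir
  split_ifs
  · rw [lvl_add_u₁]; simpa using h
  · rw [lvl_add_u₂]; have : ℓ + 1 - (lvl q - 2) = (ℓ - lvl q) + 3 := by ring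
    rw [this]; exact dvd_add h (dvd_refl 3)
  · rw [lvl_add_u₃]; simpa using h

/-! ## §2 Face helices -/

/-- **The columns along a face cycle**: starting at `q`, step by the up-directions `udir a, udir (a+s), udir (a+2s), …` where `s ∈ {1, 2}` selects the
face type (upward or downward triangle); after three steps the column is `q` again (`u₁ + u₂ + u₃ = 0`). [folklore] -/
def faceCol (q : Site 2) (a s : ℕ) : ℕ → Site 2
  | 0 => q
  | i + 1 => faceCol q a s i + udir (a + s * i)

/-- **The `n`-step helix from `(q, ℓ₀)`**: the vertices `(faceCol q a s i, ℓ₀ + i)`, `i = 0, …, n`. [folklore] -/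
def helix (k : ℕ) (q : Site 2) (a s : ℕ) (ℓ₀ : ℤ) (n : ℕ) : List (slab111 k) :=
  (List.range (n + 1)).map fun i => vl k (faceCol q a s i) (ℓ₀ + i)

/-- All levels of a helix are admissible when the first is of the right residue and the range lies in `[0, k]`. [folklore] -/
theorem adm_faceCol {q : Site 2} (a s : ℕ) {ℓ₀ : ℤ} (hres : (3 : ℤ) ∣ ℓ₀ - lvl q) (h0 : 0 ≤ ℓ₀) {n : ℕ} (hn : ℓ₀ + n ≤ k) (i : ℕ) (hi : i ≤ n) :
    Adm k (faceCol q a s i) (ℓ₀ + i) := by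
  refine ⟨?_, by omega, by omega⟩
  induction i with
  | zero => simpa [faceCol] using hres
  | succ i ih =>
    have := dvd_step (a + s * i) (ih (by omega))
    simp only [faceCol, Nat.cast_succ]
    convert this using 1; ring

/-- Membership in a helix. [folklore] -/
theorem mem_helix {q : Site 2} {a s : ℕ} {ℓ₀ : ℤ} {n : ℕ} {v : slab111 k} :
    v ∈ helix k q a s ℓ₀ n ↔ ∃ i, i ≤ n ∧ v = vl k (faceCol q a s i) (ℓ₀ + i) := by
  simp only [helix, List.mem_map, List.mem_range]
  constructor
  · rintro ⟨i, hi, rfl⟩; exact ⟨i, by omega, rfl⟩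
  · rintro ⟨i, hi, rfl⟩; exact ⟨i, by omega, rfl⟩

/-- The level of the `i`-th helix vertex is `ℓ₀ + i`. [folklore] -/
theorem lev_of_mem_helix {q : Site 2} {a s : ℕ} {ℓ₀ : ℤ} {n : ℕ} (hres : (3 : ℤ) ∣ ℓ₀ - lvl q) (h0 : 0 ≤ ℓ₀) (hn : ℓ₀ + n ≤ k) {v : slab111 k}
    (hv : v ∈ helix k q a s ℓ₀ n) : ℓ₀ ≤ lev (v : Site 3) ∧ lev (v : Site 3) ≤ ℓ₀ + n := by
  obtain ⟨i, hi, rfl⟩ := mem_helix.1 hv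
  rw [lev_vl (adm_faceCol a s hres h0 hn i hi)]
  constructor <;> omega

/-- **A helix segment is a self-avoiding path of the film** from `vl q ℓ₀` to `vl (faceCol q a s n) (ℓ₀ + n)`.
[cite: DuminilCopinSidoraviciusTassion2016, §2.3 (proof of Fact 2: the paths γ_u, γ_v, γ_w)] -/
theorem helix_gpath {q : Site 2} {a s : ℕ} {ℓ₀ : ℤ} {n : ℕ} (hres : (3 : ℤ) ∣ ℓ₀ - lvl q) (h0 : 0 ≤ ℓ₀) (hn : ℓ₀ + n ≤ k) :
    GPath (film k) (helix k q a s ℓ₀ n) (vl k q ℓ₀) (vl k (faceCol q a s n) (ℓ₀ + n)) := by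
  induction n with
  | zero => simpa [helix, faceCol] using GPath.single (film k) (vl k q ℓ₀)
  | succ n ih =>
    have hn' : ℓ₀ + n ≤ k := by push_cast at hn; omega
    have hprev := ih hn'
    have hstep : (film k).Adj (vl k (faceCol q a s n) (ℓ₀ + n)) (vl k (faceCol q a s (n + 1)) (ℓ₀ + (n + 1 : ℕ))) := by
      have hadm := adm_faceCol a s hres h0 hn' n le_rfl
      have hadm' := adm_faceCol a s hres h0 hn (n + 1) le_rfl
      simp only [faceCol, Nat.cast_succ] at hadm' ⊢
      have e : ℓ₀ + (n + 1 : ℤ) = ℓ₀ + n + 1 := by ring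
      rw [e] at hadm' ⊢
      exact adj_vl_udir _ hadm hadm'
    have hlist : helix k q a s ℓ₀ (n + 1) = helix k q a s ℓ₀ n ++ [vl k (faceCol q a s (n + 1)) (ℓ₀ + (n + 1 : ℕ))] := by
      simp [helix, List.range_succ]
    rw [hlist]
    have hnew : vl k (faceCol q a s (n + 1)) (ℓ₀ + (n + 1 : ℕ)) ∉ helix k q a s ℓ₀ n := by
      intro hmem
      have := (lev_of_mem_helix hres h0 hn' hmem).2
      rw [lev_vl (adm_faceCol a s hres h0 hn (n + 1) le_rfl)] at this
      push_cast at this; omega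
    have := hprev.trans (GPath.pair hstep) (fun v hv hvl => by
      rcases List.mem_cons.1 hv with rfl | hv
      · rfl
      · simp only [List.mem_singleton] at hv
        exact absurd (hv ▸ hvl) hnew)
    simpa using this

end Slab111

end Summit.CriticalPhenomena.PercolationContinuityZ3.Theorems.Transplant

end
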